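import Mathlib

/-!
PORT NOTE (val-port-3 g3; desk val-lit RULINGS #365 (B) / #366 (C)(iii); author val-idea-41 g3, ALL CREDIT): Negative-lane port of the crux workfile
`Cruxes/NNDivisionHard/PermBlind41.lean` @a440a32060f5 (tree sha16 62fe778729d1fda9, 536 l.; `import Mathlib` only; 0 `sorry`; critic of record val-idea-crit-9 g2 VERDICT (rows 69–73 block, 2026-08-28T23:34:49Z): «★★ KEEP (R1 instrument, VERIFIED) — `permPassenger_cliqueBlind` axioms std»), texts VERBATIM BY NAME under the Negative-lane namespace `…Theorems.NNDivisionHardNegative.PermBlind`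
(the workfile's `…Cruxes.NNDivisionHard.PermBlind41` is not importable from `Theorems/`); the ONLY other changes are 36 one-line docstrings on helper
lemmas/defs (gate lint), the scratch's `set_option linter.unusedVariables false` DROPPED and the five unused binders of `col0`–`col3`/`col5`–`col7` `_`-prefixed instead (0 warnings), and the 400-line-cap SPLIT: part 1 (this file) =
§0 indicators, §1 double-sum bookkeeping, §2 atom families; part 2 `…/Negative/PermBlindFactorization.lean` = §3 `slack_identity`, §4 `factorization` /
★ `permPassenger_cliqueBlind`.

AUTHOR'S MODULE DOCSTRING (val-idea-41 g3, verbatim):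

# PermBlind41 — the permutahedral passenger is clique-row blind (a NON-CUBE blind passenger)

W6-R1 (b142) enemy hunt, val-idea-41 g3, crux `FifoMatching.NNDivisionHard` (stmt 21181).

**Theorem (`permPassenger_cliqueBlind`).**  For every `n` there are entrywise nonnegative
matrices `U` (rows `a ⊆ [n]`) and `V` (columns `(b ⊆ [n], π ∈ S_n)`) with an index set of
`(n+1)·(8n²+1)` slots such that for all `a b π`

  `(1 - |a ∩ b|)² + (4n+2) · inv(a;π) = ∑ₛ U a s · V (b,π) s`,

where `inv(a;π) = #{(l ∈ a, l' ∉ a) : π l' < π l}`.  The left side is exactly the slack of the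
clique row `udRow a` against the column `udPt b + q_π` of `COR(n) + Q^Π_λ`, where
`Q^Π_λ = conv{−λ·diag(π) : π ∈ S_n}` is the (scaled, negated) PERMUTAHEDRON placed on the
diagonal (`⟨udRow a, −λ diag π⟩ = −λ Σ_{l∈a} π(l)`, maximal iff `a` occupies the first `|a|`
positions of `π`, recourse `λ·inv(a;π)`).  Hence `Q^Π_{4n+2}` is CLIQUE-ROW BLIND with
`O(n³)` slots although it is not an affine cube (it has `n!` vertices and extension complexity
`Θ(n log n)` [Goemans 2015]); all blind passengers on record so far (Q♮, Q∘, Q^c, Q^w) were cubes.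

**The explicit factorization** (row `a` with `|a| = k`; the column then knows the located set
`I = I^π_k` = first `k` elements of `π` and `s' = |I ∩ b|`; `y_l = [l ∈ a∖I]`, `z_l = [l ∈ I∖a]`,
`d = |a∖I| = |I∖a|`, `m = |(I∖a)∩b|`, `t = |(a∖I)∩b|`, so that `|a∩b| = s' − m + t`):
`A0 = (1−s')²`, `A1 = m²`, `A2 = t²`, `A3 = Σ_{l∉I,l'∈I} (y_l z_{l'}(2−2b_lb_{l'}) + 2 y_l x_{l'})
 = 2kd − 2mt`, `A4+A6 = Σ_{l∉I} y_l (2 − 2b_l + 2s'b_l + λ(π(l)−k) − 4k − 2)`,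
`A5 = Σ_{l'∈I} z_{l'}(2k + 2(1−s')b_{l'})`, `A7 = λ Σ x_l x_{l''}[π l > k][π l'' > π l]`,
`A8 = λ Σ (1−x_{l'}) x_l [π l' < π l ≤ k]`; and `λ·inv = λΣ_{l∈a∖I}(π(l)−k) + A7 + A8` because an
`a`-element outside `I` at position `p` has exactly `p − k + #{a-elements after it}` non-`a`
predecessors.  Every column factor is `≥ 0` as soon as `λ ≥ 4k+2` (`s' ≤ k`).  The identity was
first verified numerically (`pub/ideators/val-idea-41/check_perm_nmf.py`, exact for all
`(a,b,π)` at `n ≤ 4`) and is kernel-checked below (`slack_identity`).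

**Why it matters for C⁺ = `LocatedPencilLaw`.**  `Q^Π` has tilt-DEAD columns (only diagonal
entries move), passes the located-face tests of `LocatedFace41` (its located faces are products
of sub-permutahedra) and the single-column negative-tilt test (CRITIC-wave6 N20) — so it is the
one enemy candidate for C⁺ that survives every recorded test; by the off-diagonal shadow sieve
(`OffDiagShadow41.permPassenger_three_pow_le`, = PROP D₀) it is nevertheless DEAD at COR-VIRTUAL.
For `Q^Π` an off-diagonal entry tilt only adds a separable COR-side cost, so
C⁺-blindness of `Q^Π` ⇔ blindness of the DIAGONALLY tilted rows `(a, w)`, `w ∈ ℝⁿ`, slack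
`(1−|a∩b|)² + Σ_l (w_l⁺(1−b_l) + w_l⁻ b_l) + λ·Def(𝟙_a + w; π)`,
`Def(c;π) = Σ_{c_l > c_{l'}, π l > π l'} (c_l − c_{l'})`.  OPEN (the W6-R1 dichotomy): a uniform-in-`w`
factorization ⇒ ¬`LocatedPencilLaw` by a non-cube while COR-VIRTUAL stands; a diagonal tilt
exposing UDISJ on `Q^Π` ⇒ `Q^Π` decided and no enemy candidate survives.

21181 OPEN; C⁺ OPEN; VP ≠ VNP NOT proved.  This file refutes nothing new in Law currency
(`cliqueRows.Law` is already refuted by cubes, CliqueRowLawFalse p671347); its content is the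
first non-cube witness and the explicit `O(n³)` factorization.
-/

-- the mandated summit-side namespace repeats a component by design (single-problem summit)
set_option linter.dupNamespace false

namespace Summit.ValiantsHypothesis.Theorems.NNDivisionHardNegative.PermBlind

open Finset BigOperators

noncomputable section

variable {n : ℕ}

/-! ## §0 Indicators and basic sums -/

/-- `[l ∈ a]` as a real number. -/
def xa (a : Finset (Fin n)) (l : Fin n) : ℝ := if l ∈ a then 1 else 0

/-- `[π l < k]`: `l` is among the first `k` positions of `π` (the located set `I^π_k`). -/
def io (π : Equiv.Perm (Fin n)) (k : ℕ) (l : Fin n) : ℝ := if (π l : ℕ) < k then 1 else 0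

/-- inversion kernel `[π l' < π l]`. -/
def K (π : Equiv.Perm (Fin n)) (l l' : Fin n) : ℝ := if (π l' : ℕ) < (π l : ℕ) then 1 else 0

/-- `inv(a;π) = #{(l ∈ a, l' ∉ a) : π l' < π l}` as a real double sum. -/
def invR (a : Finset (Fin n)) (π : Equiv.Perm (Fin n)) : ℝ :=
  ∑ l, ∑ l', xa a l * (1 - xa a l') * K π l l'

/-- `inv(a;π)` as a cardinality. -/
def inv (a : Finset (Fin n)) (π : Equiv.Perm (Fin n)) : ℕ :=
  ((univ : Finset (Fin n × Fin n)).filter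
    (fun p => p.1 ∈ a ∧ p.2 ∉ a ∧ (π p.2 : ℕ) < (π p.1 : ℕ))).card

/-- The clique-row slack of `COR(n) + Q^Π_λ`: `UDISJ + λ·inv`. -/
def M (lam : ℝ) (a b : Finset (Fin n)) (π : Equiv.Perm (Fin n)) : ℝ :=
  (1 - ∑ l, xa a l * xa b l) ^ 2 + lam * invR a π

/-- `xa ≥ 0`. (docstring added in the port) -/
lemma xa_nonneg (a : Finset (Fin n)) (l : Fin n) : 0 ≤ xa a l := by
  unfold xa; split_ifs <;> norm_num

/-- `xa ≤ 1`. (docstring added in the port) -/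
lemma xa_le_one (a : Finset (Fin n)) (l : Fin n) : xa a l ≤ 1 := by
  unfold xa; split_ifs <;> norm_num

/-- `xa` is idempotent. (docstring added in the port) -/
lemma xa_mul_self (a : Finset (Fin n)) (l : Fin n) : xa a l * xa a l = xa a l := by
  unfold xa; split_ifs <;> norm_num

/-- `io ≥ 0`. (docstring added in the port) -/
lemma io_nonneg (π : Equiv.Perm (Fin n)) (k : ℕ) (l : Fin n) : 0 ≤ io π k l := by
  unfold io; split_ifs <;> norm_num

/-- `io ≤ 1`. (docstring added in the port) -/
lemma io_le_one (π : Equiv.Perm (Fin n)) (k : ℕ) (l : Fin n) : io π k l ≤ 1 := by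
  unfold io; split_ifs <;> norm_num

/-- `K ≥ 0`. (docstring added in the port) -/
lemma K_nonneg (π : Equiv.Perm (Fin n)) (l l' : Fin n) : 0 ≤ K π l l' := by
  unfold K; split_ifs <;> norm_num

/-- `Σ_l xa a l = |a|`. (docstring added in the port) -/
lemma sum_xa (a : Finset (Fin n)) : ∑ l, xa a l = a.card := by
  unfold xa
  rw [Finset.sum_boole]
  congr 2
  ext l; simp

/-- `Σ_l xa a l · xa b l = |a ∩ b|`. (docstring added in the port) -/
lemma sum_xa_mul_xa (a b : Finset (Fin n)) : ∑ l, xa a l * xa b l = ((a ∩ b).card : ℝ) := by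
  have h : ∀ l, xa a l * xa b l = if l ∈ a ∩ b then 1 else 0 := by
    intro l; unfold xa
    by_cases h1 : l ∈ a <;> by_cases h2 : l ∈ b <;> simp [h1, h2]
  simp_rw [h]
  rw [Finset.sum_boole]
  congr 2
  ext l; simp

/-- `Σ_i [i < m] = m` over `Fin n`, for `m ≤ n`. -/
lemma sum_indicator_lt (m : ℕ) (hm : m ≤ n) :
    ∑ i : Fin n, (if (i : ℕ) < m then (1 : ℝ) else 0) = m := by
  rw [Finset.sum_boole]
  have : ((univ : Finset (Fin n)).filter (fun i : Fin n => (i : ℕ) < m)).card = m := by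
    rw [Fin.card_filter_val_lt, min_eq_right hm]
  rw [this]

/-- `|I^π_k| = k`. -/
lemma sum_io (π : Equiv.Perm (Fin n)) (k : ℕ) (hk : k ≤ n) : ∑ l, io π k l = k := by
  unfold io
  rw [Equiv.sum_comp π (fun i : Fin n => if (i : ℕ) < k then (1 : ℝ) else 0)]
  exact sum_indicator_lt k hk

/-- `Σ_{l'} [π l' < π l] = π l` (the number of predecessors). -/
lemma sum_K (π : Equiv.Perm (Fin n)) (l : Fin n) : ∑ l', K π l l' = ((π l : ℕ) : ℝ) := by
  unfold K
  rw [Equiv.sum_comp π (fun i : Fin n => if (i : ℕ) < (π l : ℕ) then (1 : ℝ) else 0)]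
  exact sum_indicator_lt (π l : ℕ) (le_of_lt (π l).isLt)

/-- trichotomy: `[π l' < π l] + [π l < π l'] = [l ≠ l']`. -/
lemma K_add_K (π : Equiv.Perm (Fin n)) (l l' : Fin n) :
    K π l l' + K π l' l = if l = l' then 0 else 1 := by
  by_cases h : l = l'
  · subst h; simp [K]
  · have hne : (π l : ℕ) ≠ (π l' : ℕ) := by
      intro h'
      apply h
      exact π.injective (Fin.ext h')
    rcases lt_trichotomy (π l' : ℕ) (π l : ℕ) with h1 | h1 | h1
    · simp [K, h, h1, not_lt.mpr h1.le]
    · exact absurd h1.symm hne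
    · simp [K, h, h1, not_lt.mpr h1.le]

/-- a predecessor of a located element is located: `[π l < k]·[π l' < π l]·[¬ π l' < k] = 0`. -/
lemma io_K_io (π : Equiv.Perm (Fin n)) (k : ℕ) (l l' : Fin n) :
    io π k l * K π l l' * (1 - io π k l') = 0 := by
  unfold io K
  by_cases h1 : (π l : ℕ) < k <;> by_cases h2 : (π l' : ℕ) < (π l : ℕ) <;> simp [h1, h2]
  have h3 : (π l' : ℕ) < k := lt_trans h2 h1
  simp [h3]

/-- `inv` (cardinality) equals `invR` (real double sum). -/
lemma inv_cast (a : Finset (Fin n)) (π : Equiv.Perm (Fin n)) : (inv a π : ℝ) = invR a π := by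
  unfold inv invR
  have h : ∀ l l', xa a l * (1 - xa a l') * K π l l' =
      if (l ∈ a ∧ l' ∉ a ∧ (π l' : ℕ) < (π l : ℕ)) then 1 else 0 := by
    intro l l'; unfold xa K
    by_cases h1 : l ∈ a <;> by_cases h2 : l' ∈ a <;> by_cases h3 : (π l' : ℕ) < (π l : ℕ) <;>
      simp [h1, h2, h3]
  simp_rw [h]
  rw [← Fintype.sum_prod_type', Finset.sum_boole]

/-! ## §1 Double-sum bookkeeping -/

/-- Double sums agree when the summands agree. (docstring added in the port) -/
lemma dsum_congr {F G : Fin n → Fin n → ℝ} (h : ∀ l l', F l l' = G l l') :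
    ∑ l, ∑ l', F l l' = ∑ l, ∑ l', G l l' := by
  refine Finset.sum_congr rfl (fun l _ => Finset.sum_congr rfl (fun l' _ => h l l'))

/-- A double sum of a product of one-variable factors is a product of sums. (docstring added in the port) -/
lemma dsum_prod (f g : Fin n → ℝ) : ∑ l, ∑ l', f l * g l' = (∑ l, f l) * (∑ l', g l') := by
  rw [Finset.sum_mul_sum]

/-- Double sums are additive. (docstring added in the port) -/
lemma dsum_add (F G : Fin n → Fin n → ℝ) :
    ∑ l, ∑ l', (F l l' + G l l') = (∑ l, ∑ l', F l l') + ∑ l, ∑ l', G l l' := by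
  rw [← Finset.sum_add_distrib]
  refine Finset.sum_congr rfl (fun l _ => Finset.sum_add_distrib)

/-- Double sums respect subtraction. (docstring added in the port) -/
lemma dsum_sub (F G : Fin n → Fin n → ℝ) :
    ∑ l, ∑ l', (F l l' - G l l') = (∑ l, ∑ l', F l l') - ∑ l, ∑ l', G l l' := by
  rw [← Finset.sum_sub_distrib]
  refine Finset.sum_congr rfl (fun l _ => Finset.sum_sub_distrib _ _)

/-- Constants pull out of double sums. (docstring added in the port) -/
lemma dsum_const_mul (c : ℝ) (F : Fin n → Fin n → ℝ) :
    ∑ l, ∑ l', c * F l l' = c * ∑ l, ∑ l', F l l' := by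
  rw [Finset.mul_sum]
  refine Finset.sum_congr rfl (fun l _ => by rw [Finset.mul_sum])

/-- A Kronecker-delta double sum collapses to a single sum. (docstring added in the port) -/
lemma dsum_delta (F : Fin n → Fin n → ℝ) :
    ∑ l, ∑ l', (if l' = l then (1 : ℝ) else 0) * F l l' = ∑ l, F l l := by
  refine Finset.sum_congr rfl (fun l _ => ?_)
  have : ∀ l', (if l' = l then (1 : ℝ) else 0) * F l l' = if l' = l then F l l' else 0 := by
    intro l'; split_ifs <;> simp
  simp_rw [this]
  simp

/-! ## §2 The atom families -/

/-- `s' = |I ∩ b|`. -/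
def sI (π : Equiv.Perm (Fin n)) (k : ℕ) (b : Finset (Fin n)) : ℝ := ∑ l, io π k l * xa b l

/-- row factor types: `0 ↦ (1−x)(1−x')`, `1 ↦ x x'`, `2 ↦ x (1−x')`. -/
def row0 (a : Finset (Fin n)) (l l' : Fin n) : ℝ := (1 - xa a l) * (1 - xa a l')
/-- row factor type `1 ↦ x x'`. (docstring added in the port) -/
def row1 (a : Finset (Fin n)) (l l' : Fin n) : ℝ := xa a l * xa a l'
/-- row factor type `2 ↦ x (1 − x')`. (docstring added in the port) -/
def row2 (a : Finset (Fin n)) (l l' : Fin n) : ℝ := xa a l * (1 - xa a l')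

/-- the eight column factors (A1, A2, A3a, A3b, A4+A6, A5, A7, A8 of the header). -/
def col0 (_lam : ℝ) (b : Finset (Fin n)) (π : Equiv.Perm (Fin n)) (k : ℕ) (l l' : Fin n) : ℝ :=
  io π k l * io π k l' * xa b l * xa b l'
/-- column factor A2 (see module docstring). (docstring added in the port) -/
def col1 (_lam : ℝ) (b : Finset (Fin n)) (π : Equiv.Perm (Fin n)) (k : ℕ) (l l' : Fin n) : ℝ :=
  (1 - io π k l) * (1 - io π k l') * xa b l * xa b l'
/-- column factor A3a. (docstring added in the port) -/
def col2 (_lam : ℝ) (b : Finset (Fin n)) (π : Equiv.Perm (Fin n)) (k : ℕ) (l l' : Fin n) : ℝ :=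
  (1 - io π k l) * io π k l' * (2 - 2 * xa b l * xa b l')
/-- column factor A3b. (docstring added in the port) -/
def col3 (_lam : ℝ) (_b : Finset (Fin n)) (π : Equiv.Perm (Fin n)) (k : ℕ) (l l' : Fin n) : ℝ :=
  (1 - io π k l) * io π k l' * 2
/-- column factor A4+A6 (diagonal, carries the budget `λ(π l + 1 − k) − 4k − 2`). (docstring added in the port) -/
def col4 (lam : ℝ) (b : Finset (Fin n)) (π : Equiv.Perm (Fin n)) (k : ℕ) (l l' : Fin n) : ℝ :=
  (if l' = l then 1 else 0) * ((1 - io π k l) *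
    (2 - 2 * xa b l + 2 * sI π k b * xa b l + (lam * (((π l : ℕ) : ℝ) + 1 - k) - 4 * k - 2)))
/-- column factor A5 (diagonal). (docstring added in the port) -/
def col5 (_lam : ℝ) (b : Finset (Fin n)) (π : Equiv.Perm (Fin n)) (k : ℕ) (l l' : Fin n) : ℝ :=
  (if l' = l then 1 else 0) * (io π k l * (2 * k + 2 * (1 - sI π k b) * xa b l))
/-- column factor A7 (`λ(1 − io)·K`). (docstring added in the port) -/
def col6 (lam : ℝ) (_b : Finset (Fin n)) (π : Equiv.Perm (Fin n)) (k : ℕ) (l l' : Fin n) : ℝ :=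
  lam * (1 - io π k l) * K π l' l
/-- column factor A8 (`λ·io·io·K`). (docstring added in the port) -/
def col7 (lam : ℝ) (_b : Finset (Fin n)) (π : Equiv.Perm (Fin n)) (k : ℕ) (l l' : Fin n) : ℝ :=
  lam * io π k l * io π k l' * K π l l'

/-- row factor of family `i`. -/
def rowv (i : Fin 8) (a : Finset (Fin n)) (l l' : Fin n) : ℝ :=
  ![row0 a l l', row1 a l l', row2 a l l', row1 a l l', row1 a l l', row0 a l l', row1 a l l',
    row2 a l l'] i

/-- column factor of family `i`. -/
def colv (i : Fin 8) (lam : ℝ) (b : Finset (Fin n)) (π : Equiv.Perm (Fin n)) (k : ℕ)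
    (l l' : Fin n) : ℝ :=
  ![col0 lam b π k l l', col1 lam b π k l l', col2 lam b π k l l', col3 lam b π k l l',
    col4 lam b π k l l', col5 lam b π k l l', col6 lam b π k l l', col7 lam b π k l l'] i

/-- Every row factor is nonnegative. (docstring added in the port) -/
lemma rowv_nonneg (i : Fin 8) (a : Finset (Fin n)) (l l' : Fin n) : 0 ≤ rowv i a l l' := by
  have h0 : 0 ≤ row0 a l l' :=
    mul_nonneg (by linarith [xa_le_one a l]) (by linarith [xa_le_one a l'])
  have h1 : 0 ≤ row1 a l l' := mul_nonneg (xa_nonneg a l) (xa_nonneg a l')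
  have h2 : 0 ≤ row2 a l l' := mul_nonneg (xa_nonneg a l) (by linarith [xa_le_one a l'])
  fin_cases i <;> simp [rowv, h0, h1, h2]

/-- `s' ≥ 0`. (docstring added in the port) -/
lemma sI_nonneg (π : Equiv.Perm (Fin n)) (k : ℕ) (b : Finset (Fin n)) : 0 ≤ sI π k b :=
  Finset.sum_nonneg (fun l _ => mul_nonneg (io_nonneg π k l) (xa_nonneg b l))

/-- `s' ≤ k` for `k ≤ n`. (docstring added in the port) -/
lemma sI_le (π : Equiv.Perm (Fin n)) (k : ℕ) (hk : k ≤ n) (b : Finset (Fin n)) :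
    sI π k b ≤ k := by
  calc sI π k b ≤ ∑ l, io π k l := by
        refine Finset.sum_le_sum (fun l _ => ?_)
        have := mul_le_mul_of_nonneg_left (xa_le_one b l) (io_nonneg π k l)
        simpa using this
    _ = k := sum_io π k hk

/-- Every column factor is nonnegative once `λ ≥ 4n + 2`. (docstring added in the port) -/
lemma colv_nonneg (i : Fin 8) (lam : ℝ) (b : Finset (Fin n)) (π : Equiv.Perm (Fin n)) (k : ℕ)
    (hk : k ≤ n) (hlam : 4 * (n : ℝ) + 2 ≤ lam) (l l' : Fin n) : 0 ≤ colv i lam b π k l l' := by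
  have hι := io_nonneg π k l
  have hι' := io_nonneg π k l'
  have hι1 : 0 ≤ 1 - io π k l := by linarith [io_le_one π k l]
  have hι1' : 0 ≤ 1 - io π k l' := by linarith [io_le_one π k l']
  have hβ := xa_nonneg b l
  have hβ' := xa_nonneg b l'
  have hβ1 := xa_le_one b l
  have hβ1' := xa_le_one b l'
  have hs := sI_nonneg π k b
  have hsk := sI_le π k hk b
  have hkn : (k : ℝ) ≤ n := by exact_mod_cast hk
  have hlam0 : 0 ≤ lam := by linarith [(Nat.cast_nonneg n : (0 : ℝ) ≤ n)]
  have h0 : 0 ≤ col0 lam b π k l l' := by unfold col0; positivity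
  have h1 : 0 ≤ col1 lam b π k l l' := by
    unfold col1; exact mul_nonneg (mul_nonneg (mul_nonneg hι1 hι1') hβ) hβ'
  have h2 : 0 ≤ col2 lam b π k l l' := by
    unfold col2
    refine mul_nonneg (mul_nonneg hι1 hι') ?_
    nlinarith [mul_le_mul hβ1 hβ1' hβ' (by norm_num : (0 : ℝ) ≤ 1)]
  have h3 : 0 ≤ col3 lam b π k l l' := by
    unfold col3; exact mul_nonneg (mul_nonneg hι1 hι') (by norm_num)
  have h4 : 0 ≤ col4 lam b π k l l' := by
    unfold col4
    refine mul_nonneg (by split_ifs <;> norm_num) ?_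
    -- `(1 - io) * (...)`: if `io = 1` the product vanishes; else `π l ≥ k`.
    by_cases hlt : (π l : ℕ) < k
    · have : io π k l = 1 := by simp [io, hlt]
      rw [this]; simp
    · have hio : io π k l = 0 := by simp [io, hlt]
      have hpos : (k : ℝ) ≤ ((π l : ℕ) : ℝ) := by exact_mod_cast (not_lt.mp hlt)
      rw [hio]
      have hA : 0 ≤ 2 - 2 * xa b l + 2 * sI π k b * xa b l := by nlinarith
      have hB : 0 ≤ lam * (((π l : ℕ) : ℝ) + 1 - k) - 4 * k - 2 := by nlinarith
      linarith
  have h5 : 0 ≤ col5 lam b π k l l' := by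
    unfold col5
    refine mul_nonneg (by split_ifs <;> norm_num) (mul_nonneg hι ?_)
    nlinarith
  have h6 : 0 ≤ col6 lam b π k l l' := by
    unfold col6; exact mul_nonneg (mul_nonneg hlam0 hι1) (K_nonneg π l' l)
  have h7 : 0 ≤ col7 lam b π k l l' := by
    unfold col7; exact mul_nonneg (mul_nonneg (mul_nonneg hlam0 hι) hι') (K_nonneg π l l')
  fin_cases i <;> simp [colv, h0, h1, h2, h3, h4, h5, h6, h7]

end

end Summit.ValiantsHypothesis.Theorems.NNDivisionHardNegative.PermBlind
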